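import Summits.BirchSwinnertonDyer.Rank1Residual.Supersingular.X6RankZeroWitness22678e1LowerHalf
import Summits.BirchSwinnertonDyer.Rank1Residual.Supersingular.X7SevenCongruenceCertificates
import Summits.BirchSwinnertonDyer.BirchSwinnertonDyer.Theorems.Rank2ObservatoryKernelCertsR98
import HarnessLib

/-!
# Leaf `ClassX6 ∧ r_an = 0` (A6), residual `EisensteinHalfFiveLeRest` of route `PrintX6`: the cell `(12927e1, p = 7)` —
# the typed LOWER half `MissingLowerBoundAt W 7` (and the Rest conclusion at the cell) by `7`-VISIBILITY from the
# same-level rank-2 partner `12927d1`, the `7`-congruence PROVED in the kernel on Fisher's `X_E(7)`, NO Kato-side binder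
# (cell `bsd-print-x6`, seat p4 gen 3 — «explicit descent/visibility certificate road»; `--supports` the Rest child; closes no item)

PARTITION currency (D-0054): leaf A6 = X6 ∧ r_an = 0; ONE cell of the declared residual (all bad primes split multiplicative:
`12927 = 3·31·139`, `a₃ = a₃₁ = a₁₃₉ = +1`, so `¬ HasErratumPrime` — one of the 6 Rest cells of the census N < 5·10⁵, and the
only one without a kernel closure so far: its record of reference was the data row `VisibilityRecords.checked_x6_rankZero_visibility`
and Kurihara certificates threading C.-H. Kim's flagged theorem); nothing booked here; BEYOND-PRINT THEOREM: **NO**.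

WHAT THIS FILE DOES (pattern = `X6RankZeroWitness22678e1LowerHalf.lean` §3 at `p = 5` and `X6VisibilitySevenRecords01.lean` at
`p = 7`, nothing new in method): `E = 12927e1 = [1,0,0,−42189461,−105479619702]` (Cremona; `Δ = −3·31²·139`, good supersingular at
`7` with `#Ẽ(𝔽₇) = 8`, `#Ш_an = 49`, `∏c_ℓ = 2`, `E(ℚ)_tors = 0`, `L(E,1)/Ω = 98`) and its `7`-congruent partner
`F = 12927d1 = [1,0,0,−137,606]` of rank `2` (`Δ_F = −3²·31·139`).
* §1 models: ellipticity / Kraus minimality of both, `#Ẽ(𝔽₇) = 8`, and `2 ≤ rank F(ℚ)` BY NAME from the rank-2 observatory's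
  kernel certificate `Rank2Observatory.KernelCertsR98.C12927d1.two_le_rank`.
* §2 `sevenCongruent_x6_12927e1_12927d1_7`: `F[7] ≅ E[7]` as `Γ_ℚ`-modules from the rational point
  `P = (−22276103123 : 495013 : 66)` of Fisher's twisted Klein quartic `X_E(7) = {𝓕 = 0}` (Thm 3.9 coordinates for the
  `c₄,c₆`-model of `E`, `c₄ = 2025094129`, `c₆ = 91131353781335`) with `E_P ≅ F` over `ℚ` by the scaling `u = 4304295936/11`
  (`d₁(P) = −65102476032 ≠ 0`, `H(𝓕)(P) ≠ 0`), checked by `decide +kernel` through `sevenCongruent_of_twistCertificate7`;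
  conditional only on the PUBLISHED fact `thm48_sevenCongruent_twistQuartic7` (Fisher 2014 Thm 4.8). Point found exactly by
  resultant + rational roots (kit j284736, PARI via cypari2, < 2 s; `X_E⁻(7)` has no rational point above `j(F)`: the congruence is direct).
* §3 `X6RankZero.missingLowerBoundAt_cell_12927e1_at7`: the LOWER half from the generic hW-free shape
  `X6RankZero.missingLowerBoundAt_of_casselsTate_of_congr_of_places₄` (p545273): places `S = {3, 7, 31, 139}`, paid place
  `T = {7}` (`7·#F(ℚ₇)[7] = 7 < 49 ≤ 7^{rank F}`), `3, 31, 139` of kind (i) (`#F(ℚ_ℓ)[7] = 1` by the kernel decider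
  `sevenTorsionCheckAt`: empty certificates at `3, 31, 7`; at `139` the three `ℤ₁₃₉`-roots `x ≡ 102, 72, 79` of `ψ₇` have
  non-square `g(x)`), `r_an = 0`, `#Ш_an = q`, `ord₇ q ≤ 2` from the engine's level-one enclosure `hball0` of `L(E,1)/Ω = 98`
  (`analyticRank_shaAn_of_LOneBall_of_rowCheckZ`; Tate rows: split `I₁, I₂, I₁` at `3, 31, 139`, `∏c = 2`), two engines:
  PARI 2.15 `ellL1`/`omega` (60 digits, exactly 98) and an independent pure-Python point count + mpmath series/AGM-free quadrature
  (`|L/Ω − 98| < 10⁻²⁹`), kit j284736 (evidence on the crux item).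
* §4 `X6RankZero.eisensteinHalfFiveLeRest_cell_12927e1_at7`: the conclusion of the Rest child (and of E₅) AT THE CELL —
  `∀ q, #Ш(E)_an = q → ord₇ q ≠ 0 → ord₇ q ≤ ord₇ #Ш(E/ℚ)` — binders EXACTLY {Cassels–Tate `hCT`, GZK `hGZK`, period comparison
  `hϖ`, Tate uniformisation `hU`/`hU2`, Fisher 2016 Thm 4.4 `hF44`, Fisher 2014 Thm 4.8 `hF7`, the two models, the newform `f`/`hf`,
  `hball0`}: no Wuthrich Prop. 21, no modularity-as-entire-L binder, no Kato-side input, no flagged fact. With the route's own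
  upper half (`UpperHalfX6`, PROVED from `PublishedInputsX6`) a `Theorems/PrintX6*` file closes `BSD(E,7)` at the cell on the
  route's trust base (this module must not import the route).

References: [CremonaMazur2000] §3; [Fisher2014SevenElevenCongruent] Thm 3.9/4.6/4.8; [Fisher2016Visualizing7] Thm 4.4;
[SilvermanATAEC1994] V.5.3/5.4, IV.9.4; [SilvermanAEC2009] VII.5.1, X.4.14; [Cassels1962ArithmeticIV]; [Miller2011LMS] Def 1.1;
[GreenbergVatsal2000] §3 Rem 3.4; [CremonaAlgorithms1997] §2.8, Table 1; [Cremona2006] (labels 12927e1, 12927d1).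
-/

set_option autoImplicit false

noncomputable section

open scoped Classical MatrixGroups ModularForm

open CongruenceSubgroup WeierstrassCurve Literature.NumberTheory.EllipticCurves
  Literature.NumberTheory.EllipticCurves.Rank1Residual
  Literature.NumberTheory.EllipticCurves.Rank1Residual.Typed
  Literature.NumberTheory.EllipticCurves.Rank1Residual.X11RankOneCertificates
  Literature.NumberTheory.EllipticCurves.Wuthrich2014
  Literature.NumberTheory.EllipticCurves.Fisher2016
  Literature.NumberTheory.EllipticCurves.Fisher2014
  Summit.BirchSwinnertonDyer.BirchSwinnertonDyer.Rank1Residual.IntModel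
  Summit.BirchSwinnertonDyer.Rank1Residual.X11b
  Literature.NumberTheory.EllipticCurves.ModularForms
  Summit.BirchSwinnertonDyer.BirchSwinnertonDyer.Rank2Observatory.Tam
open NumberField IsDedekindDomain Rat.HeightOneSpectrum
open Summit.BirchSwinnertonDyer.Rank1Residual.Supersingular.LocalOddTorsion

namespace Summit.BirchSwinnertonDyer.Rank1Residual.Supersingular

/-! ### §1 The two models: `12927e1` (target) and `12927d1` (rank-2 partner) -/

/-- `12927e1` (Cremona's minimal model) is an elliptic curve: `Δ = −3·31²·139 ≠ 0`. [cite: Cremona2006, Table 1 (Cremona label 12927e1)] -/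
theorem isElliptic_c12927e1 : (⟨1, 0, 0, -42189461, -105479619702⟩ : WeierstrassCurve ℚ).IsElliptic :=
  isElliptic_of_discOf_ne_zero 1 0 0 (-42189461) (-105479619702) (by decide +kernel)

/-- `12927e1` is globally minimal (Kraus' bounded criterion, kernel; `|Δ| = 400737 < 512¹²`). [cite: SilvermanAEC2009, VII.1 Remark 1.1] -/
theorem isGloballyMinimal_c12927e1 :
    (⟨1, 0, 0, -42189461, -105479619702⟩ : WeierstrassCurve ℚ).IsGloballyMinimal :=
  isGloballyMinimal_of_krausCriterion_bounded₂ 1 0 0 (-42189461) (-105479619702) (by decide +kernel)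
    (by decide +kernel) (by decide +kernel)

/-- The partner `12927d1` (Cremona's minimal model) is an elliptic curve: `Δ = −3²·31·139 ≠ 0`.
[cite: Cremona2006, Table 1 (Cremona label 12927d1)] -/
theorem isElliptic_c12927d1 : (⟨1, 0, 0, -137, 606⟩ : WeierstrassCurve ℚ).IsElliptic :=
  isElliptic_of_discOf_ne_zero 1 0 0 (-137) 606 (by decide +kernel)

/-- The partner `12927d1` is globally minimal (Kraus' bounded criterion, kernel). [cite: SilvermanAEC2009, VII.1 Remark 1.1] -/
theorem isGloballyMinimal_c12927d1 : (⟨1, 0, 0, -137, 606⟩ : WeierstrassCurve ℚ).IsGloballyMinimal :=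
  isGloballyMinimal_of_krausCriterion_bounded₂ 1 0 0 (-137) 606 (by decide +kernel) (by decide +kernel) (by decide +kernel)

/-- `#Ẽ(𝔽₇) = 8` for `12927e1` (`a₇ = 0`: good SUPERSINGULAR at `7`; kernel count). [folklore] -/
theorem card_c12927e1_7 :
    Nat.card (((⟨1, 0, 0, -42189461, -105479619702⟩ : WeierstrassCurve ℤ).map
      (Int.castRingHom (ZMod 7))).toAffine.Point) = 8 :=
  haveI : Fact (Nat.Prime 7) := ⟨by norm_num⟩
  natCard_point_eq_of_countPoints 1 0 0 (-42189461) (-105479619702) 7 (by norm_num) (by decide +kernel)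
    (by decide +kernel)

/-- **`2 ≤ rank 12927d1(ℚ)` IN THE KERNEL, BY NAME**: the rank-2 observatory's rational kernel certificate
`Rank2Observatory.KernelCertsR98.C12927d1.two_le_rank` (generators `(7, −5)`, `(19/4, 47/8)`, odd-torsion annihilator and doubling
witnesses, `decide +kernel`), transported along `(⟨1,0,0,−137,606⟩ : 𝓦 ℤ).map ℤ→ℚ = ⟨1,0,0,−137,606⟩`.
[cite: CremonaAlgorithms1997, Table 1, §3.5] [cite: SilvermanAEC2009, Thm. VIII.6.7] -/
theorem two_le_rank_c12927d1 : 2 ≤ (⟨1, 0, 0, -137, 606⟩ : WeierstrassCurve ℚ).mordellWeilRank := by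
  have h : (⟨1, 0, 0, -137, 606⟩ : WeierstrassCurve ℤ).map (Int.castRingHom ℚ) = ⟨1, 0, 0, -137, 606⟩ := by
    ext <;> simp [WeierstrassCurve.map]
  rw [← h]
  exact Summit.BirchSwinnertonDyer.BirchSwinnertonDyer.Rank2Observatory.KernelCertsR98.C12927d1.two_le_rank

/-! ### §2 The `7`-congruence `12927d1[7] ≅ 12927e1[7]`: a kernel certificate on Fisher's `X_E(7)` -/

/-- **`12927d1[7] ≅ 12927e1[7]`** (`Γ_ℚ`-modules) from the point `P = (−22276103123 : 495013 : 66)` of `X_E(7)` (`E = 12927e1`,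
`c₄ = 2025094129`, `c₆ = 91131353781335`; Fisher's Thm. 3.9 coordinates), scaling `u = 4304295936/11`, `d₁(P) = −65102476032`,
`H(𝓕)(P) = 62028273813622156689408`; partner `12927d1` (`c₄ = 6577`, `c₆ = −533449`; Cremona rank 2, same level `12927`).
Kernel certificate (`decide +kernel` through `sevenCongruent_of_twistCertificate7`); conditional only on Fisher's Theorem 4.8;
point by resultant + rational roots, kit j284736 (the unique rational point above `j(F)`; `X_E⁻(7)` has none: the congruence is
direct; trace check `a_ℓ(E) ≡ a_ℓ(F) (mod 7)` at every good `ℓ ≤ 3000` in the same job).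
[cite: Fisher2014SevenElevenCongruent, Thm. 4.8 with Thm. 4.6 and Thm. 3.9] [cite: Cremona2006, Table 1 (Cremona labels 12927e1, 12927d1)] -/
theorem sevenCongruent_x6_12927e1_12927d1_7 (hF : thm48_sevenCongruent_twistQuartic7)
    {W F : WeierstrassCurve ℚ} [W.IsElliptic] [F.IsElliptic]
    (hWeq : W = ⟨1, 0, 0, -42189461, -105479619702⟩) (hFeq : F = ⟨1, 0, 0, -137, 606⟩) :
    ∃ e : geomTorsion F (7 : ℤ) ≃+ geomTorsion W (7 : ℤ),
      ∀ (σ : Field.absoluteGaloisGroup ℚ) (T : geomTorsion F (7 : ℤ)), e (σ • T) = σ • e T := by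
  refine sevenCongruent_of_twistCertificate7 hF W F 2025094129 91131353781335 6577 (-533449)
    (-22276103123) 495013 66 (4304295936 / 11 : ℚ) ?_ ?_ ?_ ?_ (by norm_num) (by norm_num) (by norm_num)
    (by decide +kernel) (by decide +kernel) (by decide +kernel) (by decide +kernel) (by decide +kernel)
  · subst hWeq; norm_num [WeierstrassCurve.c₄, WeierstrassCurve.b₂, WeierstrassCurve.b₄]
  · subst hWeq; norm_num [WeierstrassCurve.c₆, WeierstrassCurve.b₂, WeierstrassCurve.b₄, WeierstrassCurve.b₆]
  · subst hFeq; norm_num [WeierstrassCurve.c₄, WeierstrassCurve.b₂, WeierstrassCurve.b₄]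
  · subst hFeq; norm_num [WeierstrassCurve.c₆, WeierstrassCurve.b₂, WeierstrassCurve.b₄, WeierstrassCurve.b₆]

/-! ### §3 The lower half at the cell, every displayed datum discharged, no Kato-side binder -/

/-- **`12927e1` @ `7`: the typed LOWER half `MissingLowerBoundAt W 7` from `7`-visibility + Cassels–Tate, every local and analytic
datum discharged in the kernel, NO Kato-side binder.** Binders: Cassels–Tate `hCT`, GZK `hGZK`, the period comparison `hϖ` (for reading
`#Ш_an` off the enclosure), Tate uniformisation `hU`/`hU2`, Fisher 2016 Thm 4.4 `hF44`, Fisher 2014 Thm 4.8 `hF7` (⟹ the `7`-congruence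
by the certificate of §2), the two minimal models, the newform `f`/`hf` of `E`, and the engine's level-one enclosure `hball0` of
`L(E,1)/Ω⁺_f = 98` (kit j284736: PARI 60 digits exactly `98`; independent Python/mpmath `|· − 98| < 10⁻²⁹`) — which yields `r_an = 0`,
`#Ш_an = q`, `ord₇ q ≤ 2` (`analyticRank_shaAn_of_LOneBall_of_rowCheckZ`; Tate rows `I₁ @3`, `I₂ @31`, `I₁ @139`, all split, `∏c = 2`,
`7⁰ ∣ 1·1·2`, `7³ ∤ 98`). Places: `S` over `L = {3, 7, 31, 139}` (every prime divisor of `Δ_E = −3·31²·139`, `Δ_F = −3²·31·139`, and `7`),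
paid place `T = {7}` (`#F(ℚ₇)[7] = 1`, decider, empty certificate; `1·7 < 7² ≤ 7^{rank F}` by `two_le_rank_c12927d1`), kind (i) at
`3, 31` (empty certificates) and at `139` (certificate = the three `ψ₇`-root balls `102, 72, 79 (mod 139)` with non-square `g`, `S = 0`).
Composition: `X6RankZero.missingLowerBoundAt_of_casselsTate_of_congr_of_places₄`. Per pair; not a class theorem; nothing booked.
[cite: CremonaMazur2000, §3 and Table 1] [cite: Fisher2016Visualizing7, Thm. 4.4 (p. 106)] [cite: Fisher2014SevenElevenCongruent, Thm. 4.8]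
[cite: SilvermanATAEC1994, Ch. V Thm. 5.3, Cor. 5.4 and IV.9.4] [cite: SilvermanAEC2009, VII.5 Prop. 5.1 and Thm. X.4.14]
[cite: GreenbergVatsal2000, §3 Rem. 3.4] [cite: Miller2011LMS, Def. 1.1] [cite: Cremona2006, Table 1 (Cremona labels 12927e1, 12927d1)] -/
theorem X6RankZero.missingLowerBoundAt_cell_12927e1_at7
    (hCT : exists_casselsTate_pairing (K := ℚ))
    (hGZK : rank_eq_analyticRank_of_analyticRank_le_one)
    (hϖ : realPeriodRat_eq_unit_mul_plusPeriod)
    (hU : Silverman1994_thmV53_tateUniformisation.{0})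
    (hU2 : Silverman1994_thmV53_corV54_tateUniformisation.{0})
    (hF44 : thm44_selmerLocalKer_iff_of_nonsplit_good) (hF7 : thm48_sevenCongruent_twistQuartic7)
    {W F : WeierstrassCurve ℚ} [W.IsElliptic] [W.IsGloballyMinimal] [F.IsElliptic] [F.IsGloballyMinimal]
    (hWeq : W = ⟨1, 0, 0, -42189461, -105479619702⟩) (hFeq : F = ⟨1, 0, 0, -137, 606⟩)
    {N : ℕ} [NeZero N] (f : CuspForm (Gamma0 N) 2) (hf : IsNewformOf W f)
    (hball0 : ∃ mid rad : ℝ, rad ≤ 1 / 10 ^ (20 : ℕ) ∧ |mid - ((98 : ℤ) : ℝ)| ≤ 1 / 10 ^ (20 : ℕ) ∧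
      |((1 : ℕ) : ℝ) * (((1 : ℕ) : ℝ) * ((W.entireLFunction 1).re / plusPeriod f)) - mid| ≤ rad) :
    MissingLowerBoundAt W 7 := by
  haveI : Fact (Nat.Prime 7) := ⟨by norm_num⟩
  have hIW : integralModelInt W = ⟨1, 0, 0, -42189461, -105479619702⟩ :=
    integralModelInt_eq_of_map_eq _ (by rw [hWeq]; ext <;> simp [WeierstrassCurve.map])
  -- class X6 at 7 for the target (good supersingular: `7 ∤ Δ`, `#Ẽ(𝔽₇) = 8`; semistable: `gcd(Δ, c₄) = 1`)
  have hX : ClassX6 W 7 :=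
    classX6_of_intModel 7 (by norm_num) hIW (by decide +kernel) card_c12927e1_7 (by decide) (by decide +kernel)
  -- `r_an = 0`, `#Ш_an = q ∈ ℚ`, `ord₇ q ≤ 2` from the enclosure and the Tate row certificate (split I₁, I₂, I₁; ∏c = 2)
  obtain ⟨hr0, q, hq, hv⟩ := analyticRank_shaAn_of_LOneBall_of_rowCheckZ hϖ hGZK W 7 (by norm_num) hX.1 f hf
    _ _ 1 1 (by norm_num) 98 (by norm_num) hball0 hIW
    (Es := [⟨3, 1, 1, 0, 0, 0, 0, 1, 0, 0, 1⟩, ⟨31, 5, 1, 7, 0, 0, 0, 2, 0, 0, 2⟩, ⟨139, 11, 1, 25, 0, 0, 0, 1, 0, 0, 1⟩])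
    (Xs := []) (Zs := []) (by decide +kernel) (by decide +kernel) 0 2 (by decide +kernel) (by decide)
  -- the partner's rank, by name from the rank-2 observatory
  have hrank : 2 ≤ F.mordellWeilRank := by rw [hFeq]; exact two_le_rank_c12927d1
  -- the 7-congruence from the kernel certificate on X_E(7)
  obtain ⟨θ, hθ⟩ := sevenCongruent_x6_12927e1_12927d1_7 hF7 hWeq hFeq
  -- the local torsion counts #F(ℚ_ℓ)[7] = 1 at ℓ = 3, 31, 139 (kind (i)) and at the paid place 7, by the kernel decider
  have h3 : ∀ w : HeightOneSpectrum (𝓞 ℚ), (primesEquiv w : ℕ) = 3 →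
      Nat.card (nsmulAddMonoidHom 7 : (F.baseChange (w.adicCompletion ℚ)).toAffine.Point →+ _).ker = 1 := by
    intro w hw
    haveI : Fact (Nat.Prime 3) := ⟨by norm_num⟩
    refine natCard_ker_nsmul_seven_adicCompletion_eq_one_of_checkAt 3 1 0 0 (-137) 606 (by decide +kernel)
      (k := 1) (cert := []) (by decide +kernel) F ?_ hw
    rw [hFeq]; ext <;> norm_num
  have h31 : ∀ w : HeightOneSpectrum (𝓞 ℚ), (primesEquiv w : ℕ) = 31 →
      Nat.card (nsmulAddMonoidHom 7 : (F.baseChange (w.adicCompletion ℚ)).toAffine.Point →+ _).ker = 1 := by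
    intro w hw
    haveI : Fact (Nat.Prime 31) := ⟨by norm_num⟩
    refine natCard_ker_nsmul_seven_adicCompletion_eq_one_of_checkAt 31 1 0 0 (-137) 606 (by decide +kernel)
      (k := 1) (cert := []) (by decide +kernel) F ?_ hw
    rw [hFeq]; ext <;> norm_num
  have h139 : ∀ w : HeightOneSpectrum (𝓞 ℚ), (primesEquiv w : ℕ) = 139 →
      Nat.card (nsmulAddMonoidHom 7 : (F.baseChange (w.adicCompletion ℚ)).toAffine.Point →+ _).ker = 1 := by
    intro w hw
    haveI : Fact (Nat.Prime 139) := ⟨by norm_num⟩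
    refine natCard_ker_nsmul_seven_adicCompletion_eq_one_of_checkAt 139 1 0 0 (-137) 606 (by decide +kernel)
      (k := 1) (cert := [((102 : ℤ), 0, 1, 0), ((72 : ℤ), 0, 1, 0), ((79 : ℤ), 0, 1, 0)]) (by decide +kernel) F ?_ hw
    rw [hFeq]; ext <;> norm_num
  have h7 : ∀ w : HeightOneSpectrum (𝓞 ℚ), (primesEquiv w : ℕ) = 7 →
      Nat.card (nsmulAddMonoidHom 7 : (F.baseChange (w.adicCompletion ℚ)).toAffine.Point →+ _).ker = 1 := by
    intro w hw
    refine natCard_ker_nsmul_seven_adicCompletion_eq_one_of_checkAt 7 1 0 0 (-137) 606 (by decide +kernel)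
      (k := 1) (cert := []) (by decide +kernel) F ?_ hw
    rw [hFeq]; ext <;> norm_num
  -- the prime lists: every prime divisor of Δ_E, Δ_F lies in L
  set L : List ℕ := [3, 7, 31, 139] with hL
  have hLp : ∀ r ∈ L, r.Prime := by decide
  have hΔE : ∀ r : ℕ, r.Prime → (r : ℤ) ∣ (⟨1, 0, 0, -42189461, -105479619702⟩ : WeierstrassCurve ℤ).Δ → r ∈ L :=
    forall_mem_of_natAbs_eq_prod_pow L [1, 0, 2, 1] hLp (by decide +kernel)
  have hΔF : ∀ r : ℕ, r.Prime → (r : ℤ) ∣ (⟨1, 0, 0, -137, 606⟩ : WeierstrassCurve ℤ).Δ → r ∈ L :=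
    forall_mem_of_natAbs_eq_prod_pow L [2, 0, 1, 1] hLp (by decide +kernel)
  -- the sets of places S (over L) and T (over 7)
  set e := primesEquiv (R := 𝓞 ℚ) with he
  set v₇ : HeightOneSpectrum (𝓞 ℚ) := e.symm ⟨7, Fact.out⟩ with hv₇def
  have hv₇ : (e v₇ : ℕ) = 7 := by rw [hv₇def, Equiv.apply_symm_apply]
  have heq7 : ∀ w : HeightOneSpectrum (𝓞 ℚ), (e w : ℕ) = 7 → w = v₇ := by
    intro w hw
    have h1 : e w = ⟨7, Fact.out⟩ := Subtype.ext hw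
    rw [hv₇def, ← h1, Equiv.symm_apply_apply]
  set S : Finset (HeightOneSpectrum (𝓞 ℚ)) :=
    (L.filterMap fun r ↦ if h : r.Prime then some (e.symm ⟨r, h⟩) else none).toFinset with hSdef
  have hmemS : ∀ w : HeightOneSpectrum (𝓞 ℚ), w ∈ S ↔ (e w : ℕ) ∈ L := by
    intro w
    rw [hSdef, List.mem_toFinset, List.mem_filterMap]
    constructor
    · rintro ⟨r, hr, hrw⟩
      by_cases hrp : r.Prime
      · rw [dif_pos hrp, Option.some.injEq] at hrw
        rw [← hrw, Equiv.apply_symm_apply]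
        exact hr
      · rw [dif_neg hrp] at hrw
        exact absurd hrw (by simp)
    · intro hw
      refine ⟨(e w : ℕ), hw, ?_⟩
      rw [dif_pos (e w).2]
      simp
  set T : Finset (HeightOneSpectrum (𝓞 ℚ)) := {v₇} with hTdef
  have hTS : T ⊆ S := by
    intro w hw
    rw [hTdef, Finset.mem_singleton] at hw
    rw [hmemS, hw, hv₇]; decide
  -- good reduction outside S
  have hS : ∀ w : HeightOneSpectrum (𝓞 ℚ), w ∉ S →
      W.HasGoodReductionAt w ∧ F.HasGoodReductionAt w ∧ ((7 : ℕ) : 𝓞 ℚ) ∉ w.asIdeal := by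
    intro w hwS
    have hwL : (e w : ℕ) ∉ L := fun h ↦ hwS ((hmemS w).mpr h)
    have hqp : (e w : ℕ).Prime := (e w).2
    refine ⟨?_, ?_, natCast_not_mem_of_primesEquiv_ne w Fact.out fun h ↦ hwL ?_⟩
    · rw [hWeq]; exact hasGoodReductionAt_mk_of_primesEquiv _ _ _ _ _ w rfl fun h ↦ hwL (hΔE _ hqp h)
    · rw [hFeq]; exact hasGoodReductionAt_mk_of_primesEquiv _ _ _ _ _ w rfl fun h ↦ hwL (hΔF _ hqp h)
    · show (primesEquiv w : ℕ) ∈ L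
      rw [h]; decide
  -- the paid place 7: `#F(ℚ₇)[7] · #(ℤ₇/7) = 1 · 7 < 49 ≤ 7 ^ rank F`
  have hcard7 : ∏ w ∈ T, Nat.card (w.adicCompletionIntegers ℚ ⧸
      Ideal.span {((7 : ℕ) : w.adicCompletionIntegers ℚ)}) = 7 ^ Module.finrank ℚ ℚ :=
    WeierstrassCurve.prod_natCard_quot_adicCompletionIntegers (K := ℚ) (p := 7) T fun w hw h ↦
      hw (by rw [hTdef, Finset.mem_singleton]; exact heq7 w (primesEquiv_eq_of_natCast_mem Fact.out h))
  have hT : (∏ w ∈ T, Nat.card (nsmulAddMonoidHom 7 :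
        (F.baseChange (w.adicCompletion ℚ)).toAffine.Point →+ _).ker *
        Nat.card (w.adicCompletionIntegers ℚ ⧸
          Ideal.span {((7 : ℕ) : w.adicCompletionIntegers ℚ)})) < 7 ^ F.mordellWeilRank := by
    rw [Finset.prod_mul_distrib, hcard7, Module.finrank_self, hTdef, Finset.prod_singleton, h7 v₇ hv₇]
    calc (1 : ℕ) * 7 ^ 1 < 7 ^ 2 := by norm_num
      _ ≤ 7 ^ F.mordellWeilRank := Nat.pow_le_pow_right (by norm_num) hrank
  -- the free places 3, 31, 139: all of kind (i)
  have hplaces : ∀ w ∈ S, w ∉ T →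
      (((7 : ℕ) : 𝓞 ℚ) ∉ w.asIdeal ∧ Nat.card (nsmulAddMonoidHom 7 :
          (F.baseChange (w.adicCompletion ℚ)).toAffine.Point →+ _).ker = 1) ∨
      (W.HasSplitMultiplicativeReductionAt w ∧ F.HasSplitMultiplicativeReductionAt w ∧
        Nat.card (nsmulAddMonoidHom 7 :
          (W.baseChange (w.adicCompletion ℚ)).toAffine.Point →+ _).ker ≤ 7) ∨
      (W.HasMultiplicativeReductionAt w ∧ F.HasMultiplicativeReductionAt w ∧
        (∃ r : w.adicCompletion ℚ, algebraMap ℚ (w.adicCompletion ℚ) (-(W.c₄ / W.c₆)) =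
          r ^ 2 * algebraMap ℚ (w.adicCompletion ℚ) (-(F.c₄ / F.c₆))) ∧
        (∀ ζ : w.adicCompletion ℚ, ζ ^ 7 = 1 → ζ = 1)) ∨
      ((W.HasMultiplicativeReductionAt w ∧ ¬ W.HasSplitMultiplicativeReductionAt w ∧
          F.HasGoodReductionAt w) ∨
        (W.HasGoodReductionAt w ∧ F.HasMultiplicativeReductionAt w ∧
          ¬ F.HasSplitMultiplicativeReductionAt w)) := by
    intro w hwS hwT
    have hwL : (e w : ℕ) ∈ L := (hmemS w).mp hwS
    have hw7 : (e w : ℕ) ≠ 7 := fun h ↦ hwT (by rw [hTdef, Finset.mem_singleton]; exact heq7 w h)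
    have hcases : (e w : ℕ) = 3 ∨ (e w : ℕ) = 31 ∨ (e w : ℕ) = 139 := by
      simp only [hL, List.mem_cons, List.mem_nil_iff, or_false] at hwL
      omega
    rcases hcases with hw | hw | hw
    · exact Or.inl ⟨natCast_not_mem_of_primesEquiv_ne w Fact.out hw7, h3 w hw⟩
    · exact Or.inl ⟨natCast_not_mem_of_primesEquiv_ne w Fact.out hw7, h31 w hw⟩
    · exact Or.inl ⟨natCast_not_mem_of_primesEquiv_ne w Fact.out hw7, h139 w hw⟩
  exact X6RankZero.missingLowerBoundAt_of_casselsTate_of_congr_of_places₄ hCT hGZK hU hU2 hF44 W 7 (by norm_num) hX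
    hr0 hq hv F θ hθ S T hTS hS hT hplaces

/-! ### §4 The Rest conclusion (= E₅'s conclusion) at the cell -/

/-- **T3 witness INSIDE the residual `EisensteinHalfFiveLeRest`: the Eisenstein half AT THE CELL `(12927e1, 7)`, hW-free and flag-free.**
For every rational `q` with `#Ш(E)_an = q` (and `ord₇ q ≠ 0`, unused): `ord₇ q ≤ ord₇ #Ш(E/ℚ)` — the conclusion of the Rest child
`EisensteinHalfFiveLeRest` (all bad primes of `12927e1` split multiplicative: no erratum prime) and of the crux `EisensteinHalfFiveLe`
at one inhabited non-unit cell (`ord₇ #Ш_an = 2`), from `X6RankZero.missingLowerBoundAt_cell_12927e1_at7` and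
`padicValRat_le_of_missingLowerBoundAt`. Binders: Cassels–Tate, GZK, the period comparison, Tate uniformisation ×2, Fisher 2016
Thm 4.4, Fisher 2014 Thm 4.8, the two models, the newform, the enclosure — no Kato-side input. Per pair; not a class theorem.
[cite: CremonaMazur2000, §3] [cite: Fisher2014SevenElevenCongruent, Thm. 4.8] [cite: Fisher2016Visualizing7, Thm. 4.4]
[cite: SilvermanAEC2009, Thm. X.4.14] [cite: Miller2011LMS, Def. 1.1] -/
theorem X6RankZero.eisensteinHalfFiveLeRest_cell_12927e1_at7
    (hCT : exists_casselsTate_pairing (K := ℚ))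
    (hGZK : rank_eq_analyticRank_of_analyticRank_le_one)
    (hϖ : realPeriodRat_eq_unit_mul_plusPeriod)
    (hU : Silverman1994_thmV53_tateUniformisation.{0})
    (hU2 : Silverman1994_thmV53_corV54_tateUniformisation.{0})
    (hF44 : thm44_selmerLocalKer_iff_of_nonsplit_good) (hF7 : thm48_sevenCongruent_twistQuartic7)
    {W F : WeierstrassCurve ℚ} [W.IsElliptic] [W.IsGloballyMinimal] [F.IsElliptic] [F.IsGloballyMinimal]
    (hWeq : W = ⟨1, 0, 0, -42189461, -105479619702⟩) (hFeq : F = ⟨1, 0, 0, -137, 606⟩)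
    {N : ℕ} [NeZero N] (f : CuspForm (Gamma0 N) 2) (hf : IsNewformOf W f)
    (hball0 : ∃ mid rad : ℝ, rad ≤ 1 / 10 ^ (20 : ℕ) ∧ |mid - ((98 : ℤ) : ℝ)| ≤ 1 / 10 ^ (20 : ℕ) ∧
      |((1 : ℕ) : ℝ) * (((1 : ℕ) : ℝ) * ((W.entireLFunction 1).re / plusPeriod f)) - mid| ≤ rad) :
    ∀ q : ℚ, shaAn W = (q : ℂ) → padicValRat 7 q ≠ 0 → padicValRat 7 q ≤ (padicValNat 7 W.shaOrder : ℤ) := by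
  haveI : Fact (Nat.Prime 7) := ⟨by norm_num⟩
  intro q hq _
  exact padicValRat_le_of_missingLowerBoundAt W 7
    (X6RankZero.missingLowerBoundAt_cell_12927e1_at7 hCT hGZK hϖ hU hU2 hF44 hF7 hWeq hFeq f hf hball0) q hq

end Summit.BirchSwinnertonDyer.Rank1Residual.Supersingular

end
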